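import Summits.MatrixMultiplication.MatrixMultiplication.Theorems.LevelOneGL2Designs.Negative.SharpWall

/-!
# Negative lemmas for the crux `LevelOneGL2Designs` (stmt-MatrixMultiplication-14080), part W3:
the sharp level-one VOLUME caps and the empty exponent-3 cells `p ≤ 7`

Certified-compute seat (`refuter-ccert-…-14080-0`); no theorem asserts a Theses statement
positively.  From the sharp graded Neumann counts of part W2 (`D = W(p) = p³ + p² − 3p − 1`) and
the sibling chain's integer cubic budget `vol_le` (`LevelTwoBeatsCubes.Negative`):

* `volume_le_of_cubicBudget_sharp` — `|X||Y||Z| ≤ B` for every rank-1-separated triple of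
  `GL_2(𝔽_p)` as soon as `t·W(p) + t² ≤ t³ + B` for all naturals `t`, i.e. `B ≥ ψ(W) :=
  max_t (tW − t³ + t²)`;
* `volume_le_at_two/three/five/seven` — `V ≤ 6, 60, 644, 2860` (`ψ(5), ψ(26), ψ(134), ψ(370)`);
* `not_beatsCubes_at_two/three/five/seven` — the exponent-3 cell of the route's kill transfer
  (`Milestone.lean`: `V > B₃(p) = 1 + p³ + (p−2)(p+1)³ = 9, 92, 774, 2904`) is EMPTY for
  `p = 2, 3, 5, 7`: the first live cell is `p = 11` (`ψ(1418) = 21032 > 16884 = B₃(11)`), as the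
  chain's notes state on paper with `D = W`; with the tree's `N₁`-counts `p = 7` would be open.
-/

set_option linter.dupNamespace false

noncomputable section

namespace Summit.MatrixMultiplication.MatrixMultiplication.Theorems.LevelOneGL2Designs.Negative

open Summit.MatrixMultiplication.MatrixMultiplication.Theorems.LieRankDesigns.Negative

variable {p : ℕ} [Fact p.Prime]

/-- **Sharp cubic budget at level one.**  If `t·W(p) + t² ≤ t³ + B` for all `t : ℕ`
(`W(p) = p³ + p² − 3p − 1`), every rank-1-separated triple of `GL_2(𝔽_p)` has `|X||Y||Z| ≤ B`. -/
theorem volume_le_of_cubicBudget_sharp {X Y Z : Finset (GLm p 2)} (hsep : RankSep 1 X Y Z) (B : ℕ)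
    (hh : ∀ t : ℕ, t * (p ^ 3 + p ^ 2 - 3 * p - 1) + t ^ 2 ≤ t ^ 3 + B) :
    X.card * Y.card * Z.card ≤ B := by
  obtain hX | ⟨x₁, hx₁⟩ := X.eq_empty_or_nonempty
  · simp [hX]
  obtain hY | ⟨y₁, hy₁⟩ := Y.eq_empty_or_nonempty
  · simp [hY]
  obtain hZ | ⟨z₁, hz₁⟩ := Z.eq_empty_or_nonempty
  · simp [hZ]
  exact Summit.MatrixMultiplication.MatrixMultiplication.Theorems.LevelTwoBeatsCubes.Negative.vol_le
    _ _ _ _ B (Finset.card_pos.mpr ⟨y₁, hy₁⟩) (neumann_X_sharp hsep hy₁ hz₁)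
    (neumann_Z_sharp hsep hx₁ hy₁) hh

/-- `ψ(5) = 6`: `5t + t² ≤ t³ + 6` for all `t`. -/
theorem cubic_hyp_two : ∀ t : ℕ, t * (2 ^ 3 + 2 ^ 2 - 3 * 2 - 1) + t ^ 2 ≤ t ^ 3 + 6 := by
  intro t
  norm_num
  rcases le_or_gt t 3 with h | h
  · interval_cases t <;> norm_num
  · have h1 : t ^ 2 * 4 ≤ t ^ 2 * t := Nat.mul_le_mul_left _ (by omega)
    nlinarith [h1]

/-- `ψ(26) = 60`: `26t + t² ≤ t³ + 60` for all `t` (tight at `t = 3`). -/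
theorem cubic_hyp_three : ∀ t : ℕ, t * (3 ^ 3 + 3 ^ 2 - 3 * 3 - 1) + t ^ 2 ≤ t ^ 3 + 60 := by
  intro t
  norm_num
  rcases le_or_gt t 7 with h | h
  · interval_cases t <;> norm_num
  · have h1 : t ^ 2 * 8 ≤ t ^ 2 * t := Nat.mul_le_mul_left _ (by omega)
    nlinarith [h1]

/-- `ψ(134) = 644`: `134t + t² ≤ t³ + 644` for all `t` (tight at `t = 7`). -/
theorem cubic_hyp_five : ∀ t : ℕ, t * (5 ^ 3 + 5 ^ 2 - 3 * 5 - 1) + t ^ 2 ≤ t ^ 3 + 644 := by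
  intro t
  norm_num
  rcases le_or_gt t 13 with h | h
  · interval_cases t <;> norm_num
  · have h1 : t ^ 2 * 14 ≤ t ^ 2 * t := Nat.mul_le_mul_left _ (by omega)
    nlinarith [h1]

/-- `ψ(370) = 2860`: `370t + t² ≤ t³ + 2860` for all `t` (tight at `t = 11`). -/
theorem cubic_hyp_seven : ∀ t : ℕ, t * (7 ^ 3 + 7 ^ 2 - 3 * 7 - 1) + t ^ 2 ≤ t ^ 3 + 2860 := by
  intro t
  norm_num
  rcases le_or_gt t 21 with h | h
  · interval_cases t <;> norm_num
  · have h1 : t ^ 2 * 22 ≤ t ^ 2 * t := Nat.mul_le_mul_left _ (by omega)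
    nlinarith [h1]

/-- **`p = 2`: every rank-1-separated triple of `GL_2(𝔽_2)` has `|X||Y||Z| ≤ 6`.** -/
theorem volume_le_at_two [Fact (Nat.Prime 2)] {X Y Z : Finset (GLm 2 2)} (hsep : RankSep 1 X Y Z) :
    X.card * Y.card * Z.card ≤ 6 :=
  volume_le_of_cubicBudget_sharp hsep 6 cubic_hyp_two

/-- **`p = 3`: every rank-1-separated triple of `GL_2(𝔽_3)` has `|X||Y||Z| ≤ 60`.** -/
theorem volume_le_at_three [Fact (Nat.Prime 3)] {X Y Z : Finset (GLm 3 2)}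
    (hsep : RankSep 1 X Y Z) : X.card * Y.card * Z.card ≤ 60 :=
  volume_le_of_cubicBudget_sharp hsep 60 cubic_hyp_three

/-- **`p = 5`: every rank-1-separated triple of `GL_2(𝔽_5)` has `|X||Y||Z| ≤ 644`.** -/
theorem volume_le_at_five [Fact (Nat.Prime 5)] {X Y Z : Finset (GLm 5 2)}
    (hsep : RankSep 1 X Y Z) : X.card * Y.card * Z.card ≤ 644 :=
  volume_le_of_cubicBudget_sharp hsep 644 cubic_hyp_five

/-- **`p = 7`: every rank-1-separated triple of `GL_2(𝔽_7)` has `|X||Y||Z| ≤ 2860`.** -/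
theorem volume_le_at_seven [Fact (Nat.Prime 7)] {X Y Z : Finset (GLm 7 2)}
    (hsep : RankSep 1 X Y Z) : X.card * Y.card * Z.card ≤ 2860 :=
  volume_le_of_cubicBudget_sharp hsep 2860 cubic_hyp_seven

/-- **The exponent-3 cell is empty at `p = 2`** (`B₃(2) = 9 > 6`). -/
theorem not_beatsCubes_at_two [Fact (Nat.Prime 2)] :
    ¬ ∃ X Y Z : Finset (GLm 2 2), RankSep 1 X Y Z ∧
      1 + 2 ^ 3 + (2 - 2) * (2 + 1) ^ 3 < X.card * Y.card * Z.card := by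
  rintro ⟨X, Y, Z, hsep, hlt⟩
  have h := volume_le_at_two hsep
  omega

/-- **The exponent-3 cell is empty at `p = 3`** (`B₃(3) = 92 > 60`). -/
theorem not_beatsCubes_at_three [Fact (Nat.Prime 3)] :
    ¬ ∃ X Y Z : Finset (GLm 3 2), RankSep 1 X Y Z ∧
      1 + 3 ^ 3 + (3 - 2) * (3 + 1) ^ 3 < X.card * Y.card * Z.card := by
  rintro ⟨X, Y, Z, hsep, hlt⟩
  have h := volume_le_at_three hsep
  omega

/-- **The exponent-3 cell is empty at `p = 5`** (`B₃(5) = 774 > 644`). -/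
theorem not_beatsCubes_at_five [Fact (Nat.Prime 5)] :
    ¬ ∃ X Y Z : Finset (GLm 5 2), RankSep 1 X Y Z ∧
      1 + 5 ^ 3 + (5 - 2) * (5 + 1) ^ 3 < X.card * Y.card * Z.card := by
  rintro ⟨X, Y, Z, hsep, hlt⟩
  have h := volume_le_at_five hsep
  omega

/-- **The exponent-3 cell is empty at `p = 7`** (`B₃(7) = 2904 > 2860 = ψ(370)`; with the `N₁`-count
`D = 385` the cap would be `3036 > 2904` and the cell would look open). The first live cell of the
route's kill transfer is therefore `p = 11`. -/
theorem not_beatsCubes_at_seven [Fact (Nat.Prime 7)] :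
    ¬ ∃ X Y Z : Finset (GLm 7 2), RankSep 1 X Y Z ∧
      1 + 7 ^ 3 + (7 - 2) * (7 + 1) ^ 3 < X.card * Y.card * Z.card := by
  rintro ⟨X, Y, Z, hsep, hlt⟩
  have h := volume_le_at_seven hsep
  omega

/-! ## Balanced sizes: `2t² − t ≤ W(p)` -/

/-- **Balanced-size cap.**  If all three sets of a rank-1-separated triple of `GL_2(𝔽_p)` have at
least `t` elements then `2t² ≤ W(p) + t` (the `X`-slab of the sharp Neumann count with
`|X|,|Y|,|Z| ≥ t`).  So `M(p) := max min(|X|,|Y|,|Z|)` satisfies `2M² − M ≤ p³ + p² − 3p − 1`: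
`M(3) ≤ 3`, `M(5) ≤ 8`, `M(7) ≤ 13`, `M(11) ≤ 26`, `M(13) ≤ 34`; the crux asks for `M(p) ≥ c·p^{3/2}`
along a sequence, i.e. saturation of this cap up to the constant (`c ≤ 1/√2`). -/
theorem two_mul_sq_le_of_min_card {X Y Z : Finset (GLm p 2)} (hsep : RankSep 1 X Y Z) {t : ℕ}
    (ht : 1 ≤ t) (hX : t ≤ X.card) (hY : t ≤ Y.card) (hZ : t ≤ Z.card) :
    2 * t ^ 2 ≤ (p ^ 3 + p ^ 2 - 3 * p - 1) + t := by
  have hYne : Y.Nonempty := Finset.card_pos.mp (by omega)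
  have hZne : Z.Nonempty := Finset.card_pos.mp (by omega)
  obtain ⟨y₁, hy₁⟩ := hYne
  obtain ⟨z₁, hz₁⟩ := hZne
  have h := neumann_X_sharp hsep hy₁ hz₁
  have h1 : t * t ≤ X.card * Z.card := Nat.mul_le_mul hX hZ
  have h2 : t * (t - 1) ≤ X.card * (Y.card - 1) := Nat.mul_le_mul hX (by omega)
  obtain ⟨s, rfl⟩ : ∃ s, t = s + 1 := ⟨t - 1, by omega⟩
  simp only [Nat.add_sub_cancel] at h2
  nlinarith [h, h1, h2]

/-- `M(5) ≤ 8`: at `p = 5` every rank-1-separated triple has `min(|X|,|Y|,|Z|) ≤ 8` (`W = 134`). -/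
theorem min_card_le_eight_at_five [Fact (Nat.Prime 5)] {X Y Z : Finset (GLm 5 2)}
    (hsep : RankSep 1 X Y Z) {t : ℕ} (hX : t ≤ X.card) (hY : t ≤ Y.card) (hZ : t ≤ Z.card) :
    t ≤ 8 := by
  by_contra hlt
  have h := two_mul_sq_le_of_min_card hsep (by omega) hX hY hZ
  norm_num at h
  nlinarith

/-- `M(7) ≤ 13`: at `p = 7` every rank-1-separated triple has `min(|X|,|Y|,|Z|) ≤ 13` (`W = 370`). -/
theorem min_card_le_thirteen_at_seven [Fact (Nat.Prime 7)] {X Y Z : Finset (GLm 7 2)}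
    (hsep : RankSep 1 X Y Z) {t : ℕ} (hX : t ≤ X.card) (hY : t ≤ Y.card) (hZ : t ≤ Z.card) :
    t ≤ 13 := by
  by_contra hlt
  have h := two_mul_sq_le_of_min_card hsep (by omega) hX hY hZ
  norm_num at h
  nlinarith

/-- `M(11) ≤ 26`: at `p = 11` (the first live exponent-3 cell) every rank-1-separated triple has
`min(|X|,|Y|,|Z|) ≤ 26` (`W = 1418`), while beating `B₃(11) = 16884` needs volume `> 25.65³`. -/
theorem min_card_le_twentysix_at_eleven [Fact (Nat.Prime 11)] {X Y Z : Finset (GLm 11 2)}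
    (hsep : RankSep 1 X Y Z) {t : ℕ} (hX : t ≤ X.card) (hY : t ≤ Y.card) (hZ : t ≤ Z.card) :
    t ≤ 26 := by
  by_contra hlt
  have h := two_mul_sq_le_of_min_card hsep (by omega) hX hY hZ
  norm_num at h
  nlinarith

end Summit.MatrixMultiplication.MatrixMultiplication.Theorems.LevelOneGL2Designs.Negative

end
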